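import Summits.Ventures.PercRepro2.CaseOneStarCertT1
import Summits.Ventures.PercRepro2.CaseOneGadgetUWA1BBlockIIQ0
import Summits.Ventures.PercRepro2.CaseOneGadgetUWA1BBlockIIQ1
import Summits.Ventures.PercRepro2.CaseOneGadgetUWA1BBlockIIQ2
import Summits.Ventures.PercRepro2.CaseOneGadgetUWA1BBlockIIQ3
import Summits.Ventures.PercRepro2.CaseOneGadgetUWA1BBlockIIQ4
import Summits.Ventures.PercRepro2.CaseOneGadgetUWA1BBlockIIQ5
import Summits.Ventures.PercRepro2.CaseOneGadgetUWA1BBlockIIQ6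
import Summits.Ventures.PercRepro2.CaseOneGadgetUWA1BBlockIIQ7
import Summits.Ventures.PercRepro2.CaseOneGadgetUWA1BBlockIIQ8
import Summits.Ventures.PercRepro2.CaseOneGadgetUWA1BBlockIIQ9
import Summits.Ventures.PercRepro2.CaseOneGadgetUWA1BBlockIIQ10
import Summits.Ventures.PercRepro2.CaseOneGadgetUWA1BBlockIIQ11
import Summits.Ventures.PercRepro2.CaseOneGadgetUWA1BBlockIIQ12
import Summits.Ventures.PercRepro2.CaseOneGadgetUWA1BBlockIIQ13
import Summits.Ventures.PercRepro2.CaseOneGadgetUWA1BBlockIIQ14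

/-!
# The gadget `u ~ {w, a₁, b}`, `w ~ {u, a₂, o}` (uwa1b): the cell certificates of `iiqAB5` (part 76i)
(blind cell PercRepro2, p1 g34; the fourth gadget anchor of the six-form calculus — all six forms of the uwa1b gadget
as plain SFacts-cone certificate chains, generated by mining/p1/g34/uwa1b/genu.py = p1 g33's gent_uwa1.py / g25's
geno.py re-targeted; P1-G33 §6–§6″, P1-G34)

Each `eBABIIQ ijk kl` is a nonnegative combination of `(pairwise atom) × (cell)` and cubic cell monomials — or, for the degree-4 ones, `M × eBABIIQ ijk kl` (`M = Σ cᵢ` the total cell mass) is a nonnegative combination of `(atom) × (cell) × (cell)` and quartic cell monomials, then `SFacts.nonneg_of_sum_mul` (`CaseOneStarCertT1`) — exact LP certificates (kit j318477, every certificate re-verified exactly; data/p1/g33/gcerts_ii_uwa1b.json, form `ii-Q`), here as exact `linear_combination`s over `SFacts` (the rational coefficients cleared by their common denominator). -/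

namespace Summit.Ventures.PercRepro2

namespace CaseOne

section CertABIIQ76i
variable {R : Type*} [Field R] [LinearOrder R] [IsStrictOrderedRing R]

set_option maxHeartbeats 0 in
/-- `eBABIIQ33332 ≥ 0`: the combination is identically zero (`ring`). -/
lemma eBABIIQ33332_nonneg (m : SCells R) (_hf : SFacts m) : 0 ≤ eBABIIQ33332 m := by
  have h : eBABIIQ33332 m = 0 := by
    unfold eBABIIQ33332 cBABIIQ00132 cBABIIQ01032 cBABIIQ01132 cBABIIQ01232 cBABIIQ02132 cBABIIQ02232 cBABIIQ02332 cBABIIQ03232 cBABIIQ03332 cBABIIQ10132 cBABIIQ10232 cBABIIQ11032 cBABIIQ11132 cBABIIQ11232 cBABIIQ11332 cBABIIQ12032 cBABIIQ12132 cBABIIQ12232 cBABIIQ12332 cBABIIQ13132 cBABIIQ13232 cBABIIQ13332 cBABIIQ20232 cBABIIQ20332 cBABIIQ21132 cBABIIQ21232 cBABIIQ21332 cBABIIQ22032 cBABIIQ22132 cBABIIQ22232 cBABIIQ22332 cBABIIQ23032 cBABIIQ23132 cBABIIQ23232 cBABIIQ23332 cBABIIQ30332 cBABIIQ31232 cBABIIQ31332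 cBABIIQ32132 cBABIIQ32232 cBABIIQ32332 cBABIIQ33032 cBABIIQ33132 cBABIIQ33232 cBABIIQ33332
    ring
  linarith [h]

end CertABIIQ76i

end CaseOne

end Summit.Ventures.PercRepro2
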